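import Summits.RiemannHypothesis.RiemannHypothesis.Theorems.GroundBartaEvenWinsBeyondArchDeflationALayerY
import Summits.RiemannHypothesis.RiemannHypothesis.Theorems.WeilWindowFlowWindowLipschitzStubFormDomainPos
import HarnessLib

/-!
# RiemannHypothesis / GroundBarta — rung 4 (`EvenWinsBeyondArch`, stmt-RiemannHypothesis-18807 / 18085):
# U-sides of the parity ladder from the A-layer certificates

Helper file (`--supports`), RH-free.  Prover A, speedrun unit `sr-gb-rung-a` (gen 2).

The Rayleigh–Ritz UPPER bound of a ladder cell from the SAME certified energies as the L-side: for a scaled window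
polynomial `v = 𝟙_{[-b,b]} P(x/b)` with certified increment polynomial `E` (`τE(τ) = 2C(0) − 2C(τ)`), a certified upper
bound `T(v) = P(v) + 𝓔_b(v) ≤ Thi` (per-vector file `…Arch<cell><name>.lean`) and a lower bound `Mlo ≤ M_b` (`…Common`):
`ε(b) = weilGroundEnergy b ≤ Thi / (b ∫_{-1}^{1} P²) − Mlo` (`dt_groundEnergy_le_of_T`; form-domain inequality
`WeilWindowFlowWindowLipschitz.stub_formDomainPos`).  Replaces the `ring`-expanded trial files `…TrialUpper*` (whose
correlation identities exceed the gate budget at `b = 3/4`).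

References: E. Bombieri, Rend. Mat. Acc. Lincei (9) 11 (2000) Thm 2, Thm 5 [Bombieri2000Weil].
-/

set_option linter.dupNamespace false

noncomputable section

open MeasureTheory Set
open scoped BigOperators

namespace Summit.RiemannHypothesis.RiemannHypothesis.Theorems.EvenWinsBeyondArch

open Literature.NumberTheory.LFunctions Literature.Analysis.ValidatedNumerics.ExpPoly
open Literature.Analysis.ValidatedNumerics.PolyMP

/-- `‖v‖² = b ∫_{-1}^{1} P²` for `v = 𝟙_{[-b,b]} P(x/b)`. [folklore] -/
theorem dt_wY_normSq (P : Poly) {b : ℚ} (hb : 0 < b) :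
    ∫ x, ‖dt_wY P b x‖ ^ 2 = (b : ℝ) * ((integPolyQ P P 1 : ℚ) : ℝ) := by
  have hbr : (0 : ℝ) < b := by exact_mod_cast hb
  obtain ⟨-, -, hnorm, -, -⟩ := Summit.RiemannHypothesis.RiemannHypothesis.Theorems.stub_incrementSplit
    (fun x : ℝ ↦ Poly.eval P (x / b)) (b : ℝ) ((Poly.continuous_eval P).comp (continuous_id.div_const _)) hbr
  unfold dt_wY
  rw [hnorm, dt_normSq_windowPolyY_eq P hb]

/-- **`ε(b) ≤ Thi/‖v‖² − Mlo`** from a certified energy upper bound of one window polynomial. [cite: Bombieri2000Weil, Thm 5] -/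
theorem dt_groundEnergy_le_of_T (P E : Poly) {b : ℚ} (hb : 0 < b)
    (hE : ∀ τ : ℝ, τ * Poly.eval E τ = Poly.eval (Poly.smul 2 (Poly.corr P P 1)) 0 - Poly.eval (Poly.smul 2 (Poly.corr P P 1)) τ)
    {Thi Mlo : ℝ} (hT : weilPoleForm (dt_wY P b) + weilDirichletEnergy (b : ℝ) (dt_wY P b) ≤ Thi)
    (hM : Mlo ≤ weilMarkovConstant (b : ℝ)) (hG : 0 < integPolyQ P P 1) :
    weilGroundEnergy (b : ℝ) ≤ Thi / ((b : ℝ) * ((integPolyQ P P 1 : ℚ) : ℝ)) - Mlo := by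
  have hbr : (0 : ℝ) < b := by exact_mod_cast hb
  obtain ⟨-, -, -, hmem, hvan⟩ := Summit.RiemannHypothesis.RiemannHypothesis.Theorems.stub_incrementSplit
    (fun x : ℝ ↦ Poly.eval P (x / b)) (b : ℝ) ((Poly.continuous_eval P).comp (continuous_id.div_const _)) hbr
  have hint := (dt_archEnergy_windowPolyY_eq P E hb hE).1
  have key := WeilWindowFlowWindowLipschitz.stub_formDomainPos (b : ℝ) hbr (dt_wY P b) hmem hvan hint
  rw [dt_wY_normSq P hb] at key
  have hGr : (0 : ℝ) < (b : ℝ) * ((integPolyQ P P 1 : ℚ) : ℝ) := mul_pos hbr (by exact_mod_cast hG)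
  rw [le_sub_iff_add_le, le_div_iff₀ hGr]
  nlinarith

end Summit.RiemannHypothesis.RiemannHypothesis.Theorems.EvenWinsBeyondArch

end
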